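import Literature.MathematicalPhysics.QuantumFieldTheory.Balaban1983to89.B9PerturbationL2Algebra
import Literature.MathematicalPhysics.QuantumFieldTheory.Balaban1983to89.B9Thm312WholeL2

/-!
# `Balaban1983to89.B9PerturbationL2Letters` — [B9] (3.131) p. 422 IN THE L² CLASS: the propagator letters 𝒫 = G′RD\*, 𝒫† = DRG′, 𝒯 = DRG′D\* between the
# weighted block-L² classes 𝔩^{(s)}, the three words B·𝒫, 𝒫†·B†, 𝒯·B·𝒫 of Δ′_π, and ★ THE BLOCK-L² BOUND OF Δ′_π ALONE — the `t` field of the N06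
# certificate's displayed `hstepL2 : … StepL2 …` (located gap G-B9-16 in L²) — from Thm 3.1 (3.42)₁₂₃ + (3.46)₄, (3.49)₁₂₃, (3.117)∕(3.36) and the transpose facts

T. Bałaban, *Propagators for lattice gauge theories in a background field*, Commun. Math. Phys. **99** (1985) 389–434 [`Balaban1985BackgroundPropagators`,
"B9"]; [4] = T. Bałaban, *Propagators and renormalization transformations for lattice gauge theories. II*, Commun. Math. Phys. **96** (1984) 223–250
[`Balaban1984PropagatorsII`].  statement-level skeleton of published theorems with citation tags; proofs where landed; nothing here is a claim about
the Yang–Mills mass gap.  Sequel of `B9PerturbationL2Algebra` (the 𝔩^{(s)} calculus and the Schur readings); see its header for the printed loci.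

THE PRINT.  p. 421: *"It is easy to find estimates for the operator Δ′_π using Theorem 3.1 and the inequality (3.49), we have to be careful only with the
third term in the definition (3.120) of Δ′_π. One of the three derivatives there has to be applied either to an expression on the right, or on the left,
of Δ′_π"*; p. 422: *"This inequality [(3.131)] and Theorem 3.3 for G₀ imply a convergence of the series (3.130), for α₀ sufficiently small, in all
norms appearing on the left-hand sides of the inequalities (3.42)–(3.47)"*; (3.46) p. 398 (the L² norms, in particular the mixed line ‖h∇_UG′(U)∇\*_Uλ‖ ≦
B₀·1·e^{−δ₀d}‖λ‖).

THE POINT.  With dag-n06-l's split Δ′_π = T_a + D·T_b, T_a = BG′RD\*, T_b = RG′B† − RG′D\*BG′RD\* (`B9PerturbationSplitAtLetters`; at the knit's models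
`B9PerturbationMajorantsAtLettersPhys.taLcoK_phys_eq_comp ∕ tbLcoKH_phys_eq_comp`), re-association alone writes Δ′_π = B·𝒫 + 𝒫†·B† − 𝒯·B·𝒫 with
𝒫 = G′RD\*, 𝒫† = DRG′, 𝒯 = DRG′D\* — IN THE L² CLASS NO DERIVATIVE IS LEFT OUTSIDE A PROPAGATOR, so p. 421's caution costs nothing: 𝒯 is Theorem 3.1's
mixed L² line (3.46)₄ (after R = ϱ(I − P) and (3.49)₂: DRG′D\* = ϱ(∇G′∇\* − (∇P)(G′∇\*))).  THIS FILE majorises, from the Schur readings of `B9PerturbationL2Algebra`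
(`gp_l2 … bd_l2`, `dvGpDvs_l2`), R := ϱ·(I − P), the row sum (2.61) at the margin σ and the member facts `Facts347` (transfer loss αδ):
* §1 `l2_GpRDvs` (𝒫 : 𝔩^{(−1/2)} → 𝔩_W^{(−3/2)}), `l2_DvRGp` (𝒫† : 𝔩_W^{(3/2)} → 𝔩^{(1/2)}), both with `constL2A ϱ B₀ C_P c L = ϱB₀L(1 + C_Pc)` at the rate
  r − σ − αδ; `l2_DvRGpDvs` (𝒯 : 𝔩^{(0)} → 𝔩^{(0)}, `constL2T ϱ B₀ C_P B₄ c L = ϱ(B₄ + C_PB₀cL)`);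
* §2 the words `l2_word1` (B·𝒫 : 𝔩^{(−1/2)} → 𝔩^{(3/2)}), `l2_word2` (𝒫†·B† : 𝔩^{(−3/2)} → 𝔩^{(1/2)}), `l2_word3` (𝒯·B·𝒫 : 𝔩^{(−1/2)} → 𝔩^{(3/2)});
* §3 ★ `hasMaj_tpi_l2_of_split` — for T = T_a + D·T_b with the two words above: T : 𝔩^{(−1)} → 𝔩^{(1)} with `constL2 ϱ B₀ C_P B₄ c L · t_B · e^{−δ_T d}` for every
  0 ≦ δ_T with δ_T + 2σ + 3αδ ≦ r ≦ min(δ₀, δ_P, δ_B, δ₄) (the SAME budget as the sup twin `B9PerturbationMajorantLetters.maj_taL ∕ maj_tbL`); ★★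
  `blockBd_tpi_of_split` — the same read back as r1's block bound ‖1_{Δ(y)}Tμ‖₂ ≦ θ·(Lʲη)⁻¹(L^{j′}η)⁻¹e^{−δ_T d}‖μ‖₂, θ = constL2·t_B: THE KERNEL OF
  `B9Thm312WholeL2.StepL2.t` VERBATIM; `stepL2_of_blockBd` — `StepL2 𝔬 R₀ H₀ (θ₁ + θ₂) δ U` from the block bounds of `𝔬.Tpi U` (θ₁) and `𝔬.T2 U` (θ₂; Δ⁽²⁾_π
  reads the FREE residual Δ⁽²⁾ of the certificate, so its L² letter stays displayed — the L² twin of `hta₂ ∕ htb₂`).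
HONEST SCOPE.  Kernel-checked bookkeeping (Schur + [4] (2.54), (2.60), (2.61)) over FREE finite carriers with block maps; Theorem 3.1 (3.42)₁₂₃ ∕ (3.46)₄,
(3.49)₁₂₃, (3.117)∕(3.36) are HYPOTHESIS SCHEMAS and the four transpose facts are hypotheses (nothing of [B9] or [4] asserted); print's t = O(1)·Mα₀ is
`constL2·t_B` with t_B = O(1)·Mα₀ the current size; count-neutral; N06 NOT discharged; one finite lattice at a time — nothing continuum ∕ ℝ⁴ ∕ OS ∕ mass gap ∕
Clay.  Cell `pub-ymgap` (HUMAN RULING D-0062), Track A node N06 [B9], WIDTH-209 piece 4 (W-e `hstepL2`), seat `pub-ymgap-dag-n06-w8` (g0), 2026-08-28.  NEW file.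
-/

namespace Literature.MathematicalPhysics.QuantumFieldTheory.Balaban1983to89.B9PerturbationL2Letters

open Literature.MathematicalPhysics.QuantumFieldTheory.Balaban1983to89
open Finset B6RandomWalk B6RandomWalkHom B9Thm34Ext B11SectG B9SectDSup B9SectDL2Decay B9Thm312Whole B9Thm312WholeClasses B9Thm312WholeL2
open B9Thm37Glue B9RWSums343to347Whole B9RWSums346Schur B9Ineq347 B9PerturbationMajorantAlgebra B9PerturbationL2Algebra

noncomputable section

variable {g : B9.Geometry} {XS XB : Type} [Fintype XS] [Fintype XB] [Fintype g.Site]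
variable {R₀ : ℝ} {H₀ : Prop}

/-! ## §0 The constants -/

/-- the common constant of the two first-order letters 𝒫 = G′RD\*, 𝒫† = DRG′ in the L² classes: ϱB₀L(1 + C_Pc).
[cite: Balaban1985BackgroundPropagators, (3.131) p.422 (bookkeeping)] -/
def constL2A (ϱ B₀ CP c L : ℝ) : ℝ := ϱ * B₀ * L * (1 + CP * c)

/-- the constant of the mixed letter 𝒯 = DRG′D\* in the L² classes: ϱ(B₄ + C_PB₀cL). [cite: Balaban1985BackgroundPropagators, (3.131) p.422 (bookkeeping)] -/
def constL2T (ϱ B₀ CP B₄ c L : ℝ) : ℝ := ϱ * (B₄ + CP * B₀ * c * L)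

/-- the constant of Δ′_π : 𝔩^{(−1)} → 𝔩^{(1)} per unit current size t_B: L·c·A·(2 + T·L²·c) with A = `constL2A`, T = `constL2T`.
[cite: Balaban1985BackgroundPropagators, (3.131) p.422 (bookkeeping)] -/
def constL2 (ϱ B₀ CP B₄ c L : ℝ) : ℝ := L * c * constL2A ϱ B₀ CP c L * (2 + constL2T ϱ B₀ CP B₄ c L * L ^ 2 * c)

omit [Fintype g.Site] in
/-- `constL2A ≥ 0`. [cite: Balaban1985BackgroundPropagators, (3.131) p.422 (bookkeeping)] -/
theorem constL2A_nonneg {ϱ B₀ CP c L : ℝ} (hϱ : 0 ≤ ϱ) (hB₀ : 0 ≤ B₀) (hCP : 0 ≤ CP) (hc : 0 ≤ c) (hL : 0 ≤ L) : 0 ≤ constL2A ϱ B₀ CP c L :=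
  mul_nonneg (mul_nonneg (mul_nonneg hϱ hB₀) hL) (by positivity)

omit [Fintype g.Site] in
/-- `constL2T ≥ 0`. [cite: Balaban1985BackgroundPropagators, (3.131) p.422 (bookkeeping)] -/
theorem constL2T_nonneg {ϱ B₀ CP B₄ c L : ℝ} (hϱ : 0 ≤ ϱ) (hB₀ : 0 ≤ B₀) (hCP : 0 ≤ CP) (hB₄ : 0 ≤ B₄) (hc : 0 ≤ c) (hL : 0 ≤ L) :
    0 ≤ constL2T ϱ B₀ CP B₄ c L :=
  mul_nonneg hϱ (by positivity)

omit [Fintype g.Site] in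
/-- `constL2 ≥ 0`. [cite: Balaban1985BackgroundPropagators, (3.131) p.422 (bookkeeping)] -/
theorem constL2_nonneg {ϱ B₀ CP B₄ c L : ℝ} (hϱ : 0 ≤ ϱ) (hB₀ : 0 ≤ B₀) (hCP : 0 ≤ CP) (hB₄ : 0 ≤ B₄) (hc : 0 ≤ c) (hL : 0 ≤ L) :
    0 ≤ constL2 ϱ B₀ CP B₄ c L := by
  have hA := constL2A_nonneg hϱ hB₀ hCP hc hL
  have hT := constL2T_nonneg hϱ hB₀ hCP hB₄ hc hL
  unfold constL2
  positivity

section Letters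

variable {blkW : XS → g.Site} {blk : XB → g.Site} {Gp P R : Module.End ℝ (XS → ℝ)} {Dv : (XS → ℝ) →ₗ[ℝ] (XB → ℝ)}
  {Dvs : (XB → ℝ) →ₗ[ℝ] (XS → ℝ)} {Bop : (XS → ℝ) →ₗ[ℝ] (XB → ℝ)} {Bdop : (XB → ℝ) →ₗ[ℝ] (XS → ℝ)}
  {B₀ CP tB B₄ r ϱ σ c : ℝ} {dF : ℕ} {δ α L₀ : ℝ}

/-! ## §1 The letters 𝒫 = G′RD\*, 𝒫† = DRG′, 𝒯 = DRG′D\* between the L² classes -/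

/-- ★ **THE LETTER 𝒫 = G′RD\* : 𝔩^{(−1/2)} → 𝔩_W^{(−3/2)}**: G′RD\* = ϱ(G′D\* − G′(PD\*)) with G′D\* ((3.46)₂, transferred by one power) and G′ ((3.46)₀, transferred by
a half power) after PD\* ((3.49)₃ in L²); majorant `constL2A·e^{−(r−σ−αδ)d}`.
[cite: Balaban1985BackgroundPropagators, p.421, (3.46) p.398, (3.49) p.399; Balaban1984PropagatorsII, (2.54)+(2.61), (2.60) p.234] -/
theorem l2_GpRDvs (hG : GeoOK g) (hF : Facts347 g R₀ H₀ dF δ α L₀) (hrow : RowSum (toB6 g R₀ H₀) σ c)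
    (hGp : HasMaj (l2R R₀ H₀ blkW hG.lenle 1) (l2R R₀ H₀ blkW hG.lenle (-1)) Gp (fun a b => B₀ * Real.exp (-(r * g.dist a b))))
    (hGpDvs : HasMaj (l2R R₀ H₀ blk hG.lenle (1 / 2)) (l2R R₀ H₀ blkW hG.lenle (-(1 / 2))) (Gp ∘ₗ Dvs)
      (fun a b => B₀ * Real.exp (-(r * g.dist a b))))
    (hPDvs : HasMaj (l2R R₀ H₀ blk hG.lenle (-(1 / 2))) (l2R R₀ H₀ blkW hG.lenle (1 / 2)) (P ∘ₗ Dvs)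
      (fun a b => CP * Real.exp (-(r * g.dist a b))))
    (hR : R = ϱ • (LinearMap.id - P)) (hϱ : 0 ≤ ϱ) (hB₀ : 0 ≤ B₀) (hCP : 0 ≤ CP) (hσ : 0 ≤ σ) (hτ : 0 ≤ α * δ)
    (hbud : 0 ≤ r - σ - α * δ) :
    HasMaj (l2R R₀ H₀ blk hG.lenle (-(1 / 2))) (l2R R₀ H₀ blkW hG.lenle (-(3 / 2))) (Gp ∘ₗ R ∘ₗ Dvs)
      (fun a b => constL2A ϱ B₀ CP c g.L * Real.exp (-((r - σ - α * δ) * g.dist a b))) := by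
  have hL1 : 1 ≤ g.L := hF.one_le_L
  have hL0 : 0 ≤ g.L := le_trans zero_le_one hL1
  -- G′D\* shifted by −1: 𝔩^{(−1/2)} → 𝔩_W^{(−3/2)}, constant B₀L, rate r − αδ
  have h1 := hasMaj_shift_l2R_nat hG hF (-1 : ℝ) 1 (by norm_num) (by norm_num) hB₀ hGpDvs
  rw [pow_one, show (1 : ℝ) / 2 + -1 = -(1 / 2) by norm_num, show -((1 : ℝ) / 2) + -1 = -(3 / 2) by norm_num] at h1
  -- G′ shifted by −1/2: 𝔩_W^{(1/2)} → 𝔩_W^{(−3/2)}, constant B₀L, rate r − αδ; then after PD\*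
  have hGp' := hasMaj_shift_l2R_nat hG hF (-(1 / 2) : ℝ) 1 (by norm_num) (by norm_num) hB₀ hGp
  rw [pow_one, show (1 : ℝ) + -(1 / 2) = 1 / 2 by norm_num, show (-1 : ℝ) + -(1 / 2) = -(3 / 2) by norm_num] at hGp'
  have h2 := hasMaj_comp_l2R hG hrow (mul_nonneg hB₀ hL0) hCP hbud (by linarith) (by linarith) hGp' hPDvs
  have h1' := hasMaj_weaken hG (mul_nonneg hB₀ hL0) le_rfl (show r - σ - α * δ ≤ r - α * δ by linarith) h1
  have hsm := (hasMaj_smul_l2R (hasMaj_sub_exp h1' h2) ϱ).congr (T' := Gp ∘ₗ R ∘ₗ Dvs) fun μ => by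
    simp only [hR, LinearMap.smul_apply, LinearMap.sub_apply, LinearMap.comp_apply, LinearMap.id_apply, map_smul, map_sub]
  refine hsm.mono fun a b => ?_
  show |ϱ| * ((B₀ * g.L + B₀ * g.L * CP * c) * Real.exp (-((r - σ - α * δ) * g.dist a b))) ≤
    constL2A ϱ B₀ CP c g.L * Real.exp (-((r - σ - α * δ) * g.dist a b))
  rw [abs_of_nonneg hϱ, ← mul_assoc]
  exact mul_le_mul_of_nonneg_right (le_of_eq (by unfold constL2A; ring)) (Real.exp_nonneg _)

/-- ★ **THE LETTER 𝒫† = DRG′ : 𝔩_W^{(3/2)} → 𝔩^{(1/2)}**: DRG′ = ϱ(DG′ − (DP)G′) ((3.46)₁, (3.49)₂, (3.46)₀); majorant `constL2A·e^{−(r−σ−αδ)d}`.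
[cite: Balaban1985BackgroundPropagators, p.421, (3.46) p.398, (3.49) p.399; Balaban1984PropagatorsII, (2.54)+(2.61), (2.60) p.234] -/
theorem l2_DvRGp (hG : GeoOK g) (hF : Facts347 g R₀ H₀ dF δ α L₀) (hrow : RowSum (toB6 g R₀ H₀) σ c)
    (hGp : HasMaj (l2R R₀ H₀ blkW hG.lenle 1) (l2R R₀ H₀ blkW hG.lenle (-1)) Gp (fun a b => B₀ * Real.exp (-(r * g.dist a b))))
    (hDvGp : HasMaj (l2R R₀ H₀ blkW hG.lenle (1 / 2)) (l2R R₀ H₀ blk hG.lenle (-(1 / 2))) (Dv ∘ₗ Gp)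
      (fun a b => B₀ * Real.exp (-(r * g.dist a b))))
    (hDvP : HasMaj (l2R R₀ H₀ blkW hG.lenle (-(1 / 2))) (l2R R₀ H₀ blk hG.lenle (1 / 2)) (Dv ∘ₗ P)
      (fun a b => CP * Real.exp (-(r * g.dist a b))))
    (hR : R = ϱ • (LinearMap.id - P)) (hϱ : 0 ≤ ϱ) (hB₀ : 0 ≤ B₀) (hCP : 0 ≤ CP) (hσ : 0 ≤ σ) (hτ : 0 ≤ α * δ)
    (hbud : 0 ≤ r - σ - α * δ) :
    HasMaj (l2R R₀ H₀ blkW hG.lenle (3 / 2)) (l2R R₀ H₀ blk hG.lenle (1 / 2)) (Dv ∘ₗ R ∘ₗ Gp)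
      (fun a b => constL2A ϱ B₀ CP c g.L * Real.exp (-((r - σ - α * δ) * g.dist a b))) := by
  have hL1 : 1 ≤ g.L := hF.one_le_L
  have hL0 : 0 ≤ g.L := le_trans zero_le_one hL1
  -- DG′ shifted by +1: 𝔩_W^{(3/2)} → 𝔩^{(1/2)}, constant B₀L, rate r − αδ
  have h1 := hasMaj_shift_l2R_nat hG hF (1 : ℝ) 1 (by norm_num) (by norm_num) hB₀ hDvGp
  rw [pow_one, show (1 : ℝ) / 2 + 1 = 3 / 2 by norm_num, show -((1 : ℝ) / 2) + 1 = 1 / 2 by norm_num] at h1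
  -- G′ shifted by +1/2: 𝔩_W^{(3/2)} → 𝔩_W^{(−1/2)}, then DP : 𝔩_W^{(−1/2)} → 𝔩^{(1/2)}
  have hGp' := hasMaj_shift_l2R_nat hG hF ((1 / 2) : ℝ) 1 (by norm_num) (by norm_num) hB₀ hGp
  rw [pow_one, show (1 : ℝ) + 1 / 2 = 3 / 2 by norm_num, show (-1 : ℝ) + 1 / 2 = -(1 / 2) by norm_num] at hGp'
  have h2 := hasMaj_comp_l2R hG hrow hCP (mul_nonneg hB₀ hL0) hbud (by linarith) (by linarith) hDvP hGp'
  have h1' := hasMaj_weaken hG (mul_nonneg hB₀ hL0) le_rfl (show r - σ - α * δ ≤ r - α * δ by linarith) h1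
  have hsm := (hasMaj_smul_l2R (hasMaj_sub_exp h1' h2) ϱ).congr (T' := Dv ∘ₗ R ∘ₗ Gp) fun μ => by
    simp only [hR, LinearMap.smul_apply, LinearMap.sub_apply, LinearMap.comp_apply, LinearMap.id_apply, map_smul, map_sub]
  refine hsm.mono fun a b => ?_
  show |ϱ| * ((B₀ * g.L + CP * (B₀ * g.L) * c) * Real.exp (-((r - σ - α * δ) * g.dist a b))) ≤
    constL2A ϱ B₀ CP c g.L * Real.exp (-((r - σ - α * δ) * g.dist a b))
  rw [abs_of_nonneg hϱ, ← mul_assoc]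
  exact mul_le_mul_of_nonneg_right (le_of_eq (by unfold constL2A; ring)) (Real.exp_nonneg _)

/-- ★ **THE MIXED LETTER 𝒯 = DRG′D\* : 𝔩^{(0)} → 𝔩^{(0)}**: DRG′D\* = ϱ(∇G′∇\* − (∇P)(G′∇\*)) — Theorem 3.1's L² line (3.46)₄ (`Thm31GpL2Mixed`, read by
`dvGpDvs_l2`) and (3.49)₂ after (3.46)₂ (one half-power transfer); majorant `constL2T·e^{−(r−σ−αδ)d}`.  In the sup class this letter does NOT exist between
pure sup sizes ((3.44) is Hölder) — the reason print moves a derivative onto G₀ (p. 421) and the reason the certificate's sup road leaves D outside T_b.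
[cite: Balaban1985BackgroundPropagators, p.421, (3.46) p.398, (3.44) p.398, (3.49) p.399; Balaban1984PropagatorsII, (2.54)+(2.61), (2.60) p.234] -/
theorem l2_DvRGpDvs (hG : GeoOK g) (hF : Facts347 g R₀ H₀ dF δ α L₀) (hrow : RowSum (toB6 g R₀ H₀) σ c)
    (hMix : HasMaj (l2R R₀ H₀ blk hG.lenle 0) (l2R R₀ H₀ blk hG.lenle 0) (Dv ∘ₗ Gp ∘ₗ Dvs) (fun a b => B₄ * Real.exp (-(r * g.dist a b))))
    (hGpDvs : HasMaj (l2R R₀ H₀ blk hG.lenle (1 / 2)) (l2R R₀ H₀ blkW hG.lenle (-(1 / 2))) (Gp ∘ₗ Dvs)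
      (fun a b => B₀ * Real.exp (-(r * g.dist a b))))
    (hDvP : HasMaj (l2R R₀ H₀ blkW hG.lenle (-(1 / 2))) (l2R R₀ H₀ blk hG.lenle (1 / 2)) (Dv ∘ₗ P)
      (fun a b => CP * Real.exp (-(r * g.dist a b))))
    (hR : R = ϱ • (LinearMap.id - P)) (hϱ : 0 ≤ ϱ) (hB₀ : 0 ≤ B₀) (hCP : 0 ≤ CP) (hB₄ : 0 ≤ B₄) (hc : 0 ≤ c) (hσ : 0 ≤ σ) (hτ : 0 ≤ α * δ)
    (hbud : 0 ≤ r - σ - α * δ) :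
    HasMaj (l2R R₀ H₀ blk hG.lenle 0) (l2R R₀ H₀ blk hG.lenle 0) (Dv ∘ₗ R ∘ₗ Gp ∘ₗ Dvs)
      (fun a b => constL2T ϱ B₀ CP B₄ c g.L * Real.exp (-((r - σ - α * δ) * g.dist a b))) := by
  have hL1 : 1 ≤ g.L := hF.one_le_L
  have hL0 : 0 ≤ g.L := le_trans zero_le_one hL1
  -- (DP)(G′D\*) : 𝔩^{(1/2)} → 𝔩^{(1/2)}, constant C_PB₀c, rate r − σ; shifted by −1/2 to 𝔩^{(0)} → 𝔩^{(0)}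
  have h2 := hasMaj_comp_l2R hG hrow hCP hB₀ (show 0 ≤ r - σ by linarith) (show r - σ ≤ r by linarith)
    (show r - σ + σ ≤ r by linarith) hDvP hGpDvs
  have h2' := hasMaj_shift_l2R_nat hG hF (-(1 / 2) : ℝ) 1 (by norm_num) (by norm_num) (mul_nonneg (mul_nonneg hCP hB₀) hc) h2
  rw [pow_one, show (1 : ℝ) / 2 + -(1 / 2) = 0 by norm_num] at h2'
  have h1' := hasMaj_weaken hG hB₄ le_rfl (show r - σ - α * δ ≤ r by linarith) hMix
  have hsm := (hasMaj_smul_l2R (hasMaj_sub_exp h1' h2') ϱ).congr (T' := Dv ∘ₗ R ∘ₗ Gp ∘ₗ Dvs) fun μ => by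
    simp only [hR, LinearMap.smul_apply, LinearMap.sub_apply, LinearMap.comp_apply, LinearMap.id_apply, map_smul, map_sub]
  refine hsm.mono fun a b => ?_
  show |ϱ| * ((B₄ + CP * B₀ * c * g.L) * Real.exp (-((r - σ - α * δ) * g.dist a b))) ≤
    constL2T ϱ B₀ CP B₄ c g.L * Real.exp (-((r - σ - α * δ) * g.dist a b))
  rw [abs_of_nonneg hϱ, ← mul_assoc]
  exact mul_le_mul_of_nonneg_right (le_of_eq (by unfold constL2T; ring)) (Real.exp_nonneg _)

/-! ## §2 The three words of Δ′_π between the L² classes -/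

/-- **WORD 1: T_a = B·𝒫 = BG′RD\* : 𝔩^{(−1/2)} → 𝔩^{(3/2)}** (B : 𝔩_W^{(−3/2)} → 𝔩^{(3/2)} after 𝒫), constant t_B·A·c, rate r − 2σ − αδ.
[cite: Balaban1985BackgroundPropagators, (3.120) p.419, (3.130)–(3.131) pp.421–422; Balaban1984PropagatorsII, (2.54)+(2.61) pp.233–234] -/
theorem l2_word1 (hG : GeoOK g) (hrow : RowSum (toB6 g R₀ H₀) σ c) {A : ℝ}
    (hP : HasMaj (l2R R₀ H₀ blk hG.lenle (-(1 / 2))) (l2R R₀ H₀ blkW hG.lenle (-(3 / 2))) (Gp ∘ₗ R ∘ₗ Dvs)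
      (fun a b => A * Real.exp (-((r - σ - α * δ) * g.dist a b))))
    (hb : HasMaj (l2R R₀ H₀ blkW hG.lenle (-(3 / 2))) (l2R R₀ H₀ blk hG.lenle (3 / 2)) Bop (fun a b => tB * Real.exp (-(r * g.dist a b))))
    (hA : 0 ≤ A) (htB : 0 ≤ tB) (hσ : 0 ≤ σ) (hτ : 0 ≤ α * δ) (hbud : 0 ≤ r - 2 * σ - α * δ) :
    HasMaj (l2R R₀ H₀ blk hG.lenle (-(1 / 2))) (l2R R₀ H₀ blk hG.lenle (3 / 2)) (Bop ∘ₗ Gp ∘ₗ R ∘ₗ Dvs)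
      (fun a b => tB * A * c * Real.exp (-((r - 2 * σ - α * δ) * g.dist a b))) :=
  hasMaj_comp_l2R hG hrow htB hA hbud (show r - 2 * σ - α * δ ≤ r - σ - α * δ by linarith)
    (show r - 2 * σ - α * δ + σ ≤ r by linarith) hb hP

/-- **WORD 2: D·(RG′B†) = 𝒫†·B† = DRG′·D\*_UΔ : 𝔩^{(−3/2)} → 𝔩^{(1/2)}** (𝒫† after B† : 𝔩^{(−3/2)} → 𝔩_W^{(3/2)}), constant A·t_B·c, rate r − 2σ − αδ — the
derivative D of dag-n06-l's left split ABSORBED by the propagator (in L² (3.46)₁ reads it). [cite: Balaban1985BackgroundPropagators, (3.120) p.419, (3.130)–(3.131) pp.421–422; Balaban1984PropagatorsII, (2.54)+(2.61) pp.233–234] -/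
theorem l2_word2 (hG : GeoOK g) (hrow : RowSum (toB6 g R₀ H₀) σ c) {A : ℝ}
    (hPd : HasMaj (l2R R₀ H₀ blkW hG.lenle (3 / 2)) (l2R R₀ H₀ blk hG.lenle (1 / 2)) (Dv ∘ₗ R ∘ₗ Gp)
      (fun a b => A * Real.exp (-((r - σ - α * δ) * g.dist a b))))
    (hbd : HasMaj (l2R R₀ H₀ blk hG.lenle (-(3 / 2))) (l2R R₀ H₀ blkW hG.lenle (3 / 2)) Bdop (fun a b => tB * Real.exp (-(r * g.dist a b))))
    (hA : 0 ≤ A) (htB : 0 ≤ tB) (hσ : 0 ≤ σ) (hτ : 0 ≤ α * δ) (hbud : 0 ≤ r - 2 * σ - α * δ) :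
    HasMaj (l2R R₀ H₀ blk hG.lenle (-(3 / 2))) (l2R R₀ H₀ blk hG.lenle (1 / 2)) ((Dv ∘ₗ R ∘ₗ Gp) ∘ₗ Bdop)
      (fun a b => A * tB * c * Real.exp (-((r - 2 * σ - α * δ) * g.dist a b))) :=
  hasMaj_comp_l2R hG hrow hA htB hbud (show r - 2 * σ - α * δ ≤ r by linarith)
    (show r - 2 * σ - α * δ + σ ≤ r - σ - α * δ by linarith) hPd hbd

omit [Fintype XS] in
/-- **WORD 3: D·(RG′D\*BG′RD\*) = 𝒯·(B·𝒫) : 𝔩^{(−1/2)} → 𝔩^{(3/2)}** — the third term of (3.120) with ALL THREE derivatives next to a propagator (𝒯 = DRG′D\* shifted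
by 3∕2, constant T·L², after word 1), constant T·L²·(t_B·A·c)·c, rate r − 2σ − 2αδ. [cite: Balaban1985BackgroundPropagators, (3.120) p.419, p.421, (3.130)–(3.131) pp.421–422; Balaban1984PropagatorsII, (2.54), (2.60)–(2.61) pp.233–234] -/
theorem l2_word3 (hG : GeoOK g) (hF : Facts347 g R₀ H₀ dF δ α L₀) (hrow : RowSum (toB6 g R₀ H₀) σ c) {A T : ℝ}
    (hT : HasMaj (l2R R₀ H₀ blk hG.lenle 0) (l2R R₀ H₀ blk hG.lenle 0) (Dv ∘ₗ R ∘ₗ Gp ∘ₗ Dvs)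
      (fun a b => T * Real.exp (-((r - σ - α * δ) * g.dist a b))))
    (hw1 : HasMaj (l2R R₀ H₀ blk hG.lenle (-(1 / 2))) (l2R R₀ H₀ blk hG.lenle (3 / 2)) (Bop ∘ₗ Gp ∘ₗ R ∘ₗ Dvs)
      (fun a b => tB * A * c * Real.exp (-((r - 2 * σ - α * δ) * g.dist a b))))
    (hA : 0 ≤ A) (hT0 : 0 ≤ T) (htB : 0 ≤ tB) (hc : 0 ≤ c) (hτ : 0 ≤ α * δ) (hbud : 0 ≤ r - 2 * σ - 2 * (α * δ)) :
    HasMaj (l2R R₀ H₀ blk hG.lenle (-(1 / 2))) (l2R R₀ H₀ blk hG.lenle (3 / 2)) ((Dv ∘ₗ R ∘ₗ Gp ∘ₗ Dvs) ∘ₗ (Bop ∘ₗ Gp ∘ₗ R ∘ₗ Dvs))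
      (fun a b => T * g.L ^ 2 * (tB * A * c) * c * Real.exp (-((r - 2 * σ - 2 * (α * δ)) * g.dist a b))) := by
  have hL0 : 0 ≤ g.L := le_trans zero_le_one hF.one_le_L
  have hT' := hasMaj_shift_l2R_nat hG hF ((3 / 2) : ℝ) 2 (by norm_num) (by norm_num) hT0 hT
  rw [show (0 : ℝ) + 3 / 2 = 3 / 2 by norm_num] at hT'
  exact hasMaj_comp_l2R hG hrow (mul_nonneg hT0 (pow_nonneg hL0 2)) (mul_nonneg (mul_nonneg htB hA) hc) hbud
    (show r - 2 * σ - 2 * (α * δ) ≤ r - 2 * σ - α * δ by linarith) (show r - 2 * σ - 2 * (α * δ) + σ ≤ r - σ - α * δ - α * δ by linarith) hT' hw1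

/-! ## §3 ★ Δ′_π between 𝔩^{(−1)} and 𝔩^{(1)}: the `StepL2.t` shape from the three sup schemas, (3.46)₄ and the transpose facts -/

variable {δ₀ δP δB δ₄ δT : ℝ}

/-- ★ **Δ′_π IN THE L² CLASSES**: for T = T_a + D·T_b with T_a = BG′RD\*, T_b = RG′B† − RG′D\*BG′RD\* (dag-n06-l's left split, the shapes of
`B9PerturbationMajorantsAtLettersPhys.taLcoK_phys_eq_comp ∕ tbLcoKH_phys_eq_comp` verbatim) and R = ϱ(I − P): T : 𝔩^{(−1)} → 𝔩^{(1)} with the majorant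
`constL2 ϱ B₀ C_P B₄ c L · t_B · e^{−δ_T d}` for every 0 ≦ δ_T with δ_T + 2σ + 3αδ ≦ r ≦ min(δ₀, δ_P, δ_B, δ₄) — from Theorem 3.1 (3.42)₁₂₃ (`Thm31GpMaj`) + its mixed L²
line (3.46)₄ (`Thm31GpL2Mixed`), (3.49)₂₃ (`Proj349Maj`; the line (3.49)₁ for P itself is not needed), the current letters (`CurrentMaj`), the four transpose facts (p. 391), the row sum (2.61) at σ and
the member facts; Schur for the letters, [4] (2.54) for the words, the p. 398 transfer four times. [cite: Balaban1985BackgroundPropagators, (3.131) p.422, (3.120) p.419, p.421, (3.42) p.397, (3.46) p.398, (3.49) p.399, (3.117) p.419, p.391; Balaban1984PropagatorsII, (2.54), (2.60)–(2.61) pp.233–234] -/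
theorem hasMaj_tpi_l2_of_split (hG : GeoOK g) (hF : Facts347 g R₀ H₀ dF δ α L₀) (hrow : RowSum (toB6 g R₀ H₀) σ c)
    (h31 : Thm31GpMaj blkW blk Gp Dv Dvs R₀ H₀ B₀ δ₀) (h4 : Thm31GpL2Mixed blk Gp Dv Dvs R₀ H₀ B₄ δ₄)
    (h49 : Proj349Maj blkW blk P Dv Dvs R₀ H₀ CP δP) (hB : CurrentMaj blkW blk Bop Bdop R₀ H₀ tB δB)
    (hGsym : IsTransposePair Gp Gp) (hDG : IsTransposePair (Dv ∘ₗ Gp) (Gp ∘ₗ Dvs))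
    (hDP : IsTransposePair (Dv ∘ₗ P) (P ∘ₗ Dvs)) (hBB : IsTransposePair Bop Bdop) (hR : R = ϱ • (LinearMap.id - P))
    {T Ta : Module.End ℝ (XB → ℝ)} {Tb : (XB → ℝ) →ₗ[ℝ] (XS → ℝ)} (hsplit : T = Ta + Dv ∘ₗ Tb) (hTa : Ta = Bop ∘ₗ Gp ∘ₗ R ∘ₗ Dvs)
    (hTb : Tb = R ∘ₗ Gp ∘ₗ Bdop - R ∘ₗ Gp ∘ₗ Dvs ∘ₗ Bop ∘ₗ Gp ∘ₗ R ∘ₗ Dvs)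
    (hϱ : 0 ≤ ϱ) (hB₀ : 0 ≤ B₀) (hCP : 0 ≤ CP) (hB₄ : 0 ≤ B₄) (htB : 0 ≤ tB) (hc : 0 ≤ c) (hσ : 0 ≤ σ) (hτ : 0 ≤ α * δ)
    (hr₀ : r ≤ δ₀) (hrP : r ≤ δP) (hrB : r ≤ δB) (hr₄ : r ≤ δ₄) (hδT₀ : 0 ≤ δT) (hδT : δT + 2 * σ + 3 * (α * δ) ≤ r) :
    HasMaj (l2R R₀ H₀ blk hG.lenle (-1)) (l2R R₀ H₀ blk hG.lenle 1) T
      (fun a b => constL2 ϱ B₀ CP B₄ c g.L * tB * Real.exp (-(δT * g.dist a b))) := by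
  have hL1 : 1 ≤ g.L := hF.one_le_L
  have hL0 : 0 ≤ g.L := le_trans zero_le_one hL1
  have hA : 0 ≤ constL2A ϱ B₀ CP c g.L := constL2A_nonneg hϱ hB₀ hCP hc hL0
  have hTc : 0 ≤ constL2T ϱ B₀ CP B₄ c g.L := constL2T_nonneg hϱ hB₀ hCP hB₄ hc hL0
  -- the Schur readings of the letters at the common rate r
  have hGp := gp_l2 hG h31 hGsym hB₀ hr₀
  have hGpDvs := gpDvs_l2 hG h31 hDG hB₀ hr₀
  have hDvGp := dvGp_l2 hG h31 hDG hB₀ hr₀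
  have hPDvs := pDvs_l2 hG h49 hDP hCP hrP
  have hDvP := dvP_l2 hG h49 hDP hCP hrP
  have hb := b_l2 hG hB hBB htB hrB
  have hbd := bd_l2 hG hB hBB htB hrB
  have hMix := dvGpDvs_l2 hG h4 hB₄ hr₄
  -- the three propagator letters
  have hP := l2_GpRDvs hG hF hrow hGp hGpDvs hPDvs hR hϱ hB₀ hCP hσ hτ (by linarith)
  have hPd := l2_DvRGp hG hF hrow hGp hDvGp hDvP hR hϱ hB₀ hCP hσ hτ (by linarith)
  have hTT := l2_DvRGpDvs hG hF hrow hMix hGpDvs hDvP hR hϱ hB₀ hCP hB₄ hc hσ hτ (by linarith)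
  -- the three words
  have w1 := l2_word1 hG hrow hP hb hA htB hσ hτ (by linarith)
  have w2 := l2_word2 hG hrow hPd hbd hA htB hσ hτ (by linarith)
  have w3 := l2_word3 hG hF hrow hTT w1 hA hTc htB hc hτ (by linarith)
  -- words 1 − 3 at the common rate, shifted by −1/2 into 𝔩^{(−1)} → 𝔩^{(1)}
  have n1 : 0 ≤ tB * constL2A ϱ B₀ CP c g.L * c := mul_nonneg (mul_nonneg htB hA) hc
  have n3 : 0 ≤ constL2T ϱ B₀ CP B₄ c g.L * g.L ^ 2 * (tB * constL2A ϱ B₀ CP c g.L * c) * c :=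
    mul_nonneg (mul_nonneg (mul_nonneg hTc (pow_nonneg hL0 2)) n1) hc
  have w1' := hasMaj_weaken hG n1 le_rfl (show r - 2 * σ - 2 * (α * δ) ≤ r - 2 * σ - α * δ by linarith) w1
  have d13 := hasMaj_shift_l2R_nat hG hF (-(1 / 2) : ℝ) 1 (by norm_num) (by norm_num) (add_nonneg n1 n3) (hasMaj_sub_exp w1' w3)
  rw [pow_one, show -((1 : ℝ) / 2) + -(1 / 2) = -1 by norm_num, show (3 : ℝ) / 2 + -(1 / 2) = 1 by norm_num] at d13
  -- word 2 shifted by +1/2 into 𝔩^{(−1)} → 𝔩^{(1)}, then weakened to the common rate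
  have n2 : 0 ≤ constL2A ϱ B₀ CP c g.L * tB * c := mul_nonneg (mul_nonneg hA htB) hc
  have w2' := hasMaj_shift_l2R_nat hG hF ((1 / 2) : ℝ) 1 (by norm_num) (by norm_num) n2 w2
  rw [pow_one, show -((3 : ℝ) / 2) + 1 / 2 = -1 by norm_num, show (1 : ℝ) / 2 + 1 / 2 = 1 by norm_num] at w2'
  have w2'' := hasMaj_weaken hG (mul_nonneg n2 hL0) le_rfl
    (show r - 2 * σ - 2 * (α * δ) - α * δ ≤ r - 2 * σ - α * δ - α * δ by linarith) w2'
  -- the sum, as the operator T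
  have hsum := (d13.add w2'').congr (T' := T) fun μ => by
    simp only [hsplit, hTa, hTb, LinearMap.add_apply, LinearMap.sub_apply, LinearMap.comp_apply, map_sub]
    abel
  refine hsum.mono fun a b => ?_
  have hd : 0 ≤ g.dist a b := hG.dnn a b
  have hexp : Real.exp (-((r - 2 * σ - 2 * (α * δ) - α * δ) * g.dist a b)) ≤ Real.exp (-(δT * g.dist a b)) :=
    Real.exp_le_exp.mpr (neg_le_neg (mul_le_mul_of_nonneg_right (by linarith) hd))
  have hK : (tB * constL2A ϱ B₀ CP c g.L * c + constL2T ϱ B₀ CP B₄ c g.L * g.L ^ 2 * (tB * constL2A ϱ B₀ CP c g.L * c) * c) * g.L +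
      constL2A ϱ B₀ CP c g.L * tB * c * g.L = constL2 ϱ B₀ CP B₄ c g.L * tB := by
    unfold constL2; ring
  show (tB * constL2A ϱ B₀ CP c g.L * c + constL2T ϱ B₀ CP B₄ c g.L * g.L ^ 2 * (tB * constL2A ϱ B₀ CP c g.L * c) * c) * g.L *
      Real.exp (-((r - 2 * σ - 2 * (α * δ) - α * δ) * g.dist a b)) +
      constL2A ϱ B₀ CP c g.L * tB * c * g.L * Real.exp (-((r - 2 * σ - 2 * (α * δ) - α * δ) * g.dist a b)) ≤
    constL2 ϱ B₀ CP B₄ c g.L * tB * Real.exp (-(δT * g.dist a b))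
  rw [← add_mul, hK]
  exact mul_le_mul_of_nonneg_left hexp (mul_nonneg (constL2_nonneg hϱ hB₀ hCP hB₄ hc hL0) htB)

/-- ★★ **THE BLOCK-L² BOUND OF Δ′_π ALONE — THE KERNEL OF `B9Thm312WholeL2.StepL2.t` VERBATIM**: under the hypotheses of `hasMaj_tpi_l2_of_split`,
‖1_{Δ(y)}Tμ‖₂ ≦ θ·(Lʲη)⁻¹·(L^{j′}η)⁻¹·e^{−δ_T d(y,y′)}‖μ‖₂ for supp μ ⊂ Δ(y′), θ = `constL2 ϱ B₀ C_P B₄ c L · t_B` (print: t = O(1)·Mα₀ with t_B = O(1)·Mα₀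
the current size of (3.117)∕(3.36)) — p. 422's *"in all norms"* for the L² norms, the located gap G-B9-16 ∕ C-r1g6-1 in L² CLOSED MODULO the displayed schemas.
[cite: Balaban1985BackgroundPropagators, (3.131) p.422, (3.46) p.398, (3.120) p.419, p.421; Balaban1984PropagatorsII, (2.54), (2.60)–(2.61) pp.233–234] -/
theorem blockBd_tpi_of_split (hG : GeoOK g) (hF : Facts347 g R₀ H₀ dF δ α L₀) (hrow : RowSum (toB6 g R₀ H₀) σ c)
    (h31 : Thm31GpMaj blkW blk Gp Dv Dvs R₀ H₀ B₀ δ₀) (h4 : Thm31GpL2Mixed blk Gp Dv Dvs R₀ H₀ B₄ δ₄)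
    (h49 : Proj349Maj blkW blk P Dv Dvs R₀ H₀ CP δP) (hB : CurrentMaj blkW blk Bop Bdop R₀ H₀ tB δB)
    (hGsym : IsTransposePair Gp Gp) (hDG : IsTransposePair (Dv ∘ₗ Gp) (Gp ∘ₗ Dvs))
    (hDP : IsTransposePair (Dv ∘ₗ P) (P ∘ₗ Dvs)) (hBB : IsTransposePair Bop Bdop) (hR : R = ϱ • (LinearMap.id - P))
    {T Ta : Module.End ℝ (XB → ℝ)} {Tb : (XB → ℝ) →ₗ[ℝ] (XS → ℝ)} (hsplit : T = Ta + Dv ∘ₗ Tb) (hTa : Ta = Bop ∘ₗ Gp ∘ₗ R ∘ₗ Dvs)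
    (hTb : Tb = R ∘ₗ Gp ∘ₗ Bdop - R ∘ₗ Gp ∘ₗ Dvs ∘ₗ Bop ∘ₗ Gp ∘ₗ R ∘ₗ Dvs)
    (hϱ : 0 ≤ ϱ) (hB₀ : 0 ≤ B₀) (hCP : 0 ≤ CP) (hB₄ : 0 ≤ B₄) (htB : 0 ≤ tB) (hc : 0 ≤ c) (hσ : 0 ≤ σ) (hτ : 0 ≤ α * δ)
    (hr₀ : r ≤ δ₀) (hrP : r ≤ δP) (hrB : r ≤ δB) (hr₄ : r ≤ δ₄) (hδT₀ : 0 ≤ δT) (hδT : δT + 2 * σ + 3 * (α * δ) ≤ r) :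
    BlockBd (g := toB6 g R₀ H₀) blk blk T
      (fun (y y' : g.Site) => constL2 ϱ B₀ CP B₄ c g.L * tB * (g.len y)⁻¹ * (g.len y')⁻¹ * Real.exp (-(δT * g.dist y y'))) := by
  have h := blockBd_of_hasMaj_l2R hG (hasMaj_tpi_l2_of_split hG hF hrow h31 h4 h49 hB hGsym hDG hDP hBB hR hsplit hTa hTb hϱ hB₀ hCP hB₄
    htB hc hσ hτ hr₀ hrP hrB hr₄ hδT₀ hδT)
  refine h.mono fun y y' => le_of_eq ?_
  rw [Real.rpow_neg_one, Real.rpow_neg_one]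
  ring

end Letters

/-! ## §4 The displayed step schema from the two block bounds -/

section Step

variable {B : B9.Backgrounds} {X Y Z W : Type} [Fintype X]

/-- **`StepL2` FROM THE TWO BLOCK BOUNDS**: the block-L² bound θ₁·(Lʲη)⁻¹(L^{j′}η)⁻¹e^{−δd} of Δ′_π (`blockBd_tpi_of_split`) and a block bound θ₂·(…) of Δ⁽²⁾_π (which
reads the certificate's FREE residual Δ⁽²⁾ and therefore stays a displayed letter — the L² twin of `hta₂ ∕ htb₂`, (3.137) in L²) give `StepL2 𝔬 R₀ H₀ (θ₁ + θ₂) δ U`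
(`t` by monotonicity, `t1` by the triangle inequality). [cite: Balaban1985BackgroundPropagators, (3.130)–(3.131) pp.421–422, (3.135)–(3.138) pp.422–423, (3.46) p.398] -/
theorem stepL2_of_blockBd (hG : GeoOK g) {𝔬 : Ops g B X Y Z W} {U : B.Cfg} {θ₁ θ₂ δ₁ : ℝ} (hθ₂ : 0 ≤ θ₂)
    (ht : BlockBd (g := toB6 g R₀ H₀) 𝔬.blk 𝔬.blk (𝔬.Tpi U)
      (fun (y y' : g.Site) => θ₁ * (g.len y)⁻¹ * (g.len y')⁻¹ * Real.exp (-(δ₁ * g.dist y y'))))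
    (ht2 : BlockBd (g := toB6 g R₀ H₀) 𝔬.blk 𝔬.blk (𝔬.T2 U)
      (fun (y y' : g.Site) => θ₂ * (g.len y)⁻¹ * (g.len y')⁻¹ * Real.exp (-(δ₁ * g.dist y y')))) :
    StepL2 𝔬 R₀ H₀ (θ₁ + θ₂) δ₁ U := by
  have hw : ∀ y y' : g.Site, 0 ≤ (g.len y)⁻¹ * (g.len y')⁻¹ * Real.exp (-(δ₁ * g.dist y y')) := fun y y' =>
    mul_nonneg (mul_nonneg (inv_nonneg.mpr (hG.lenle y)) (inv_nonneg.mpr (hG.lenle y'))) (Real.exp_nonneg _)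
  refine ⟨ht.mono fun y y' => ?_, (blockBd_add ht ht2).mono fun y y' => le_of_eq (by ring)⟩
  calc θ₁ * (g.len y)⁻¹ * (g.len y')⁻¹ * Real.exp (-(δ₁ * g.dist y y')) = θ₁ * ((g.len y)⁻¹ * (g.len y')⁻¹ * Real.exp (-(δ₁ * g.dist y y'))) := by ring
    _ ≤ (θ₁ + θ₂) * ((g.len y)⁻¹ * (g.len y')⁻¹ * Real.exp (-(δ₁ * g.dist y y'))) := mul_le_mul_of_nonneg_right (by linarith) (hw y y')
    _ = (θ₁ + θ₂) * (g.len y)⁻¹ * (g.len y')⁻¹ * Real.exp (-(δ₁ * g.dist y y')) := by ring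

end Step

end

end Literature.MathematicalPhysics.QuantumFieldTheory.Balaban1983to89.B9PerturbationL2Letters
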